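/-
Copyright (c) 2026 the pub-hodgecm-mathlib formalisation cell (harness21).  Prover seat hodgecm-mathlib-F0P3a-p06-g25 (EP-PAIRS hand, RIDER 2b; LEAD F0P3a-plan (g16) T15-11∕T15-20;
G-row reader F0P3a-p09 (g14)); 2026-09-03.
-/
import Summits.HodgeConjecture.HodgeConjecture.Theorems.F0P3cStCharTSStIwahoriHeads     -- (G6)-ST FILE E (this seat): `dim St^{I} = [ψ = 1]`, `dim St^{K₁} = 0`; brings FILE A, C, D
import Summits.HodgeConjecture.HodgeConjecture.Theorems.F0P3cStCharTSStNoSpherical      -- (G6)-ST FILE B (this seat): `dim St^{K_v} = 0`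
import Summits.HodgeConjecture.HodgeConjecture.Theorems.F0P3cStCharTSStTwist            -- ST-TWIST (this seat): `St_G(ψ) ⊗ μ∘detZ = St_G(ψμ)`, `det` twin
import Summits.HodgeConjecture.HodgeConjecture.Theorems.F0P3cStCharTSEPGlueGExplicit    -- ★ (G3)-EXPLICIT (LH10-p02): the displayed `f_EP^G`, (c1)(c2) levels
import Summits.HodgeConjecture.HodgeConjecture.Theorems.F0P3cStCharTSEPPseudoCoeffSt     -- ★ (G5) A (F0P3-p02): `norm_centerChar_eq_one`; brings ★ `isCompact_center_Gqs`
import Summits.HodgeConjecture.HodgeConjecture.Theorems.F0P3cStCharTSScTracePackage     -- ★ `isAdmissible_smoothIrrep`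
import Literature.NumberTheory.Automorphic.SmoothCharacterIndicatorCombination          -- ★ INDIC (F0P3-p02): `IrrClass.smoothTrace_mk_epShape`
import Literature.NumberTheory.Automorphic.SmoothCharacterClassLinear                   -- ★ CLASS-LINEAR (F0P3-p02): `IrrClass.smoothTrace_mk_(neg_)conj_character_mul_eq`
import HarnessLib

/-!
# F0 · P3c · line LH6 «StCharTS» — RIDER 2b «EP-PAIRS», FILE F «EP-TRACES»: the Euler–Poincaré trace table on the EP family of `G_v = U(Φ₃)(L⁺_v)`
# `Tr St_G(ψ)(f_EP) = −[ψ = 1]`, `Tr (ψ∘det_G)(f_EP) = [ψ = 1]`, `Tr St_G(ψ)(f_{St ψ′}) = [ψ = ψ′]`, `Tr St_G(ψ)(f_{det ψ′}) = −[ψ = ψ′]`, `Tr (ψ∘det_G)(f_{det ψ′}) = [ψ = ψ′]`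

Cell `pub/hodgecm-mathlib` (D-0151), FLOOR 0, crux item H413 = `stmt-HodgeConjecture-24833` (`--supports` lane, helper; seat F0P3a-p06 (g25); census «EP-PAIRS» v1 §2).
THEOREMS ONLY, in the letters of ★ (G3)-EXPLICIT `epFunction_G_explicit` (levels `K0 K1 I hK0 hK1 hI`, shape `fG hfG`, all `rfl` at the consumer) and of ★ ST-PIN
`exists_stDetFields` (`ι hιc hι detZ hdetZ`, the per-`ψ` clauses `hdet hne hJH hStL2 hDet` READ as binder-functions of `ψ`), for ANY fields `stG detG` (at the junction:
`𝔇.stG`, `𝔇.detG`, `rfl`).  HONEST LABEL: count-neutral (RIDER 2b input; closes no node); HC_CM is proved only modulo the 7 printed citations (hLiu418 =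
stmt-HodgeConjecture-24832, h413 = stmt-HodgeConjecture-24833) until rung 0 closes.

MATHEMATICS [Rogawski1990 §12.6 p. 188 (b); Kottwitz1988 §2].  With Kottwitz's `f_EP = ν(K₀)⁻¹𝟙_{K₀} + ν(K₁)⁻¹𝟙_{K₁} − ν(I)⁻¹𝟙_I`, ★ INDIC gives
`Tr σ(f_EP) = dim σ^{K₀} + dim σ^{K₁} − dim σ^{I}`; the (G6)-ST counts (FILES A–E) give `0 + 0 − [ψ = 1]` at `σ = St_G(ψ)` and `[ψ = 1]·(1 + 1 − 1)` at `σ = ψ∘det_G`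
(H2 «DET-LEVELS» at the three levels, each containing the `d(1,b,1)`).  The EP pseudo-coefficients of ★ (G5) are `f_{det ψ′} = conj(ψ′∘detZ)·f_EP`, `f_{St ψ′} = −f_{det ψ′}`;
★ CLASS-LINEAR moves the character onto the class (`Tr σ(conj ν · f) = Tr (σ ⊗ conj ν)(f)`), ST-TWIST identifies `St_G(ψ) ⊗ conj ψ′∘detZ = St_G(ψ·conj ψ′)` (and the `det` twin),
and `ψ·conj ψ′ = 1 ↔ ψ = ψ′` because continuous characters of the COMPACT centre are unitary (★ `norm_centerChar_eq_one`).

* §1 `epShape_eq` (the displayed `fG` in ★ INDIC's `•`-shape) · §2 `smoothTrace_stG_ep`, `smoothTrace_detG_ep` · §3 the conjugate character `conj ψ′` (continuity, unitarity,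
  `ψ * conj ψ′ = 1 ↔ ψ = ψ′`) · §4 `smoothTrace_stG_epSt`, `smoothTrace_stG_epDet`, `smoothTrace_detG_epDet`.

## References
* [Rogawski1990] J. D. Rogawski, *Automorphic Representations of Unitary Groups in Three Variables*, Ann. of Math. Stud. 123 (1990), §12.6 Prop. 12.6.1 (b) p. 188; §12.2 (1) p. 173.
* [Kottwitz1988] R. E. Kottwitz, *Tamagawa numbers*, Ann. of Math. 127 (1988), §2 Theorem 2.
* [BushnellHenniart2006] C. J. Bushnell, G. Henniart, *The Local Langlands Conjecture for GL(2)* (2006), §9.5 (9.5.1) p. 65.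
* [Borel1976] A. Borel, *Admissible representations … fixed under an Iwahori subgroup*, Invent. Math. 35 (1976), §3–§4.
-/

set_option autoImplicit false
-- the mandated namespace has the single-problem summit's repeated segment (`HodgeConjecture.HodgeConjecture`)
set_option linter.dupNamespace false

noncomputable section

open NumberField IsDedekindDomain MeasureTheory
open scoped Matrix MatrixGroups NNReal WithZero ComplexConjugate
open Literature.NumberTheory.Automorphic Literature.NumberTheory.Automorphic.UnitaryGroup
open Literature.NumberTheory.Rogawski1990 Literature.NumberTheory.GaloisRepresentations

namespace Summit.HodgeConjecture.HodgeConjecture.Cruxes.H413.F0P3cStCharTSEPTraces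

open Summit.HodgeConjecture.HodgeConjecture.Cruxes.H413
open Summit.HodgeConjecture.HodgeConjecture.Cruxes.H413.F0P3cStCharTSStParahoricFixed
open Summit.HodgeConjecture.HodgeConjecture.Cruxes.H413.F0P3cStCharTSStLevelsTransport
open Summit.HodgeConjecture.HodgeConjecture.Cruxes.H413.F0P3cStCharTSStNoSpherical
open Summit.HodgeConjecture.HodgeConjecture.Cruxes.H413.F0P3cStCharTSStIwahoriHeads
open Summit.HodgeConjecture.HodgeConjecture.Cruxes.H413.F0P3cStCharTSStTwist
open Summit.HodgeConjecture.HodgeConjecture.Cruxes.H413.F0P3cStCharTSEPGlueGExplicit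
open Summit.HodgeConjecture.HodgeConjecture.Cruxes.H413.F0P3cStCharTSEPPseudoCoeffSt (norm_centerChar_eq_one)
open Summit.HodgeConjecture.HodgeConjecture.Cruxes.H413.F0P3cStCharTSScTracePackage (isAdmissible_smoothIrrep)

/-! ## §1 The displayed `f_EP^G` in ★ INDIC's `•`-shape -/

/-- The function displayed by ★ (G3)-EXPLICIT (`νQv(K)⁻¹ * 𝟙_K g`, `(νQv K).toReal`) IS ★ INDIC's `Σ ± (ν.real K)⁻¹ • 𝟙_K` (pointwise, `Measure.real`).
[cite: Kottwitz1988, §2 Theorem 2] -/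
theorem epShape_eq {G : Type*} [Group G] [MeasurableSpace G] (ν : Measure G) (K0 K1 I : Subgroup G) :
    (fun g => (((ν K0).toReal : ℂ))⁻¹ * (K0 : Set G).indicator (fun _ => (1 : ℂ)) g +
        (((ν K1).toReal : ℂ))⁻¹ * (K1 : Set G).indicator (fun _ => (1 : ℂ)) g -
        (((ν I).toReal : ℂ))⁻¹ * (I : Set G).indicator (fun _ => (1 : ℂ)) g) =
      ((((ν.real (K0 : Set G) : ℂ))⁻¹ • (K0 : Set G).indicator fun _ => (1 : ℂ)) +
        (((ν.real (K1 : Set G) : ℂ))⁻¹ • (K1 : Set G).indicator fun _ => (1 : ℂ)) -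
        (((ν.real (I : Set G) : ℂ))⁻¹ • (I : Set G).indicator fun _ => (1 : ℂ))) := by
  funext g
  simp only [Pi.add_apply, Pi.sub_apply, Pi.smul_apply, smul_eq_mul, measureReal_def]

variable (L : Type) [Field L] [NumberField L] [IsCMField L] (v : HeightOneSpectrum (𝓞 ↥(maximalRealSubfield L)))
  (w : PlacesOver L v) (hw : IsCMField.complexConj L • w.1 = w.1)
  (eA : Gqs L v ≃ₜ* ↥(unitaryGroupOfForm (galAdicCompletionMap (L := L) (IsCMField.complexConj L) hw) ((StdForm.antidiagonal 3).over (w.1.adicCompletion L))))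
  (heA : ∀ g : Gqs L v,
    ((eA g : ↥(unitaryGroupOfForm (galAdicCompletionMap (L := L) (IsCMField.complexConj L) hw) ((StdForm.antidiagonal 3).over (w.1.adicCompletion L)))) : GL (Fin 3) (w.1.adicCompletion L)) =
      ((localNonsplitEquiv (IsCMField.complexConj L) (qsForm L) (IsCMField.complexConj_ne_one L) w hw g :
        ↥(unitaryGroupOfForm (galAdicCompletionMap (L := L) (IsCMField.complexConj L) hw) (placeForm (qsForm L) w.1))) : GL (Fin 3) (w.1.adicCompletion L)))

/-! ## §2 `Tr St_G(ψ)(f_EP) = −[ψ = 1]` and `Tr (ψ∘det_G)(f_EP) = [ψ = 1]` -/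

include heA in
open Classical in
set_option maxHeartbeats 1600000 in
set_option synthInstance.maxHeartbeats 400000 in
-- instance-path unification between `Gqs L v` and the literal carrier of ★ `cmPrincipalSeries`
/-- **`Tr St_G(ψ)(f_EP^G) = dim^{K₀} + dim^{K₁} − dim^{I} = 0 + 0 − [ψ = 1]`** (★ INDIC `smoothTrace_mk_epShape` at any representative — all classes of `U(Φ₃)(L⁺_v)` are admissible —,
FILE B at `K₀ = K_v` (FILE C `mem_K0_iff_mem_integralLevel`), FILE E at `K₁` and `I`). [cite: Rogawski1990, §12.6 Prop. 12.6.1 (b) p. 188; §12.2 (1) p. 173] [cite: Kottwitz1988, §2 Theorem 2] -/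
theorem smoothTrace_stG_ep (hns : ∀ w' : PlacesOver L v, IsCMField.complexConj L • w'.1 = w'.1) {ϖ : w.1.adicCompletion L}
    (hd : HermitianLattice.UnramifiedLocalConjDatum (galAdicCompletionMap (L := L) (IsCMField.complexConj L) hw) ϖ)
    (g₁ : GL (Fin 3) (w.1.adicCompletion L)) (hg₁ : (g₁ : Matrix (Fin 3) (Fin 3) (w.1.adicCompletion L)) = Matrix.diagonal ![(1 : w.1.adicCompletion L), 1, ϖ])
    (K0 K1 I : Subgroup (Gqs L v))
    (hK0 : K0 = ((glInt 3 (w.1.adicCompletion L)).subgroupOf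
      (unitaryGroupOfForm (galAdicCompletionMap (L := L) (IsCMField.complexConj L) hw) ((StdForm.antidiagonal 3).over (w.1.adicCompletion L)))).comap
        eA.toMulEquiv.toMonoidHom)
    (hK1 : K1 = (((glInt 3 (w.1.adicCompletion L)).map (MulAut.conj g₁).toMonoidHom).subgroupOf
      (unitaryGroupOfForm (galAdicCompletionMap (L := L) (IsCMField.complexConj L) hw) ((StdForm.antidiagonal 3).over (w.1.adicCompletion L)))).comap
        eA.toMulEquiv.toMonoidHom)
    (hI : I = K0 ⊓ K1)
    [MeasurableSpace (Gqs L v)] [BorelSpace (Gqs L v)] (νQv : Measure (Gqs L v)) [νQv.IsHaarMeasure]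
    (fG : Gqs L v → ℂ)
    (hfG : fG = fun g => (((νQv K0).toReal : ℂ))⁻¹ * (K0 : Set (Gqs L v)).indicator (fun _ => (1 : ℂ)) g +
      (((νQv K1).toReal : ℂ))⁻¹ * (K1 : Set (Gqs L v)).indicator (fun _ => (1 : ℂ)) g -
      (((νQv I).toReal : ℂ))⁻¹ * (I : Set (Gqs L v)).indicator (fun _ => (1 : ℂ)) g)
    (ι : ↥(normOneUnits (conjLocal L (IsCMField.complexConj L) v)) →* ↥(Subgroup.center (Gqs L v))) (hιc : Continuous ι)
    (hι : ∀ z : ↥(normOneUnits (conjLocal L (IsCMField.complexConj L) v)),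
      ((ι z).val.val.val : Matrix (Fin 3) (Fin 3) (LocalRing L v)) = (((z : (LocalRing L v)ˣ) : LocalRing L v)) • (1 : Matrix (Fin 3) (Fin 3) (LocalRing L v)))
    (detZ : Gqs L v →* ↥(Subgroup.center (Gqs L v)))
    (hdetZ : ∀ g : Gqs L v, ((detZ g).val.val.val : Matrix (Fin 3) (Fin 3) (LocalRing L v)) =
        (g.val.val : Matrix (Fin 3) (Fin 3) (LocalRing L v)).det • (1 : Matrix (Fin 3) (Fin 3) (LocalRing L v)))
    (stG detG : (↥(Subgroup.center (Gqs L v)) →* ℂˣ) → IrrClass (Gqs L v))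
    (ψ : ↥(Subgroup.center (Gqs L v)) →* ℂˣ) (hψ : Continuous ψ)
    (hopen : IsOpen (((ψ.comp detZ).ker : Subgroup (Gqs L v)) : Set (Gqs L v)))
    (hdet : detG ψ = IrrClass.mk (SmoothIrrep.ofChar (ψ.comp detZ) hopen))
    (hne : stG ψ ≠ detG ψ)
    (hJH : ∀ c : IrrClass (Gqs L v),
      c.IsConstituentOf (cmPrincipalSeries L 3 v
        (cmTorusCharPair L v (halfModulusChar (LocalRing L v) * halfModulusChar (LocalRing L v))⁻¹ (ψ.comp ι))) ↔ (c = stG ψ ∨ c = detG ψ)) :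
    (stG ψ).smoothTrace νQv fG = -(if ψ = 1 then 1 else 0) := by
  haveI : NonarchimedeanGroup (Gqs L v) := nonarchimedeanGroup_cmLocal L 3 v
  haveI : LocallyCompactSpace (Gqs L v) := locallyCompactSpace_cmDatum_local (L := L) (N := 3) (H := qsForm L) (v := v)
  obtain ⟨r, hr⟩ := IrrClass.mk_surjective (stG ψ)
  obtain ⟨hK0o, hK0c, hK1o, hK1c, hIo, hIc⟩ := isOpen_isCompact_epLevels L v w hw g₁ eA K0 K1 I hK0 hK1 hI
  obtain ⟨hμ0, hμ1, hμI⟩ := measureReal_epLevels_ne_zero L v w hw g₁ eA K0 K1 I hK0 hK1 hI νQv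
  have hshape := IrrClass.smoothTrace_mk_epShape νQv r (isAdmissible_smoothIrrep L v hns r) hK0o hK0c hK1o hK1c hIo hIc hμ0 hμ1 hμI
  rw [hfG, epShape_eq, ← hr, hshape]
  -- the three counts
  have hK0' : K0 = cmLocalIntegralLevel L 3 (qsForm L) v := Subgroup.ext fun g => mem_K0_iff_mem_integralLevel L v w hw eA heA K0 hK0 g
  have h0 : Module.finrank ℂ (r.ρ.fixedPoints K0) = 0 := by
    rw [hK0']
    exact finrank_fixedPoints_st_integralLevel_eq_zero L v hns ι hιc hι detZ hdetZ stG detG ψ hψ hopen hdet hne hJH r hr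
  have h1 : Module.finrank ℂ (r.ρ.fixedPoints K1) = 0 :=
    finrank_fixedPoints_st_K1_eq_zero L v w hw eA heA hns hd g₁ hg₁ K0 K1 I hK0 hK1 hI ι hιc hι detZ hdetZ stG detG ψ hψ hopen hdet hne hJH r hr
  have h2 : Module.finrank ℂ (r.ρ.fixedPoints I) = if ψ = 1 then 1 else 0 :=
    finrank_fixedPoints_st_I L v w hw eA heA hns hd g₁ hg₁ K0 K1 I hK0 hK1 hI ι hιc hι detZ hdetZ stG detG ψ hψ hopen hdet hne hJH r hr
  rw [h0, h1, h2]
  split_ifs <;> simp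

include heA in
open Classical in
/-- **`Tr (ψ∘det_G)(f_EP^G) = [ψ = 1]·(1 + 1 − 1) = [ψ = 1]`** (★ INDIC at the representative `𝟙 ⊗ ψ∘detZ` of the pin clause `hdet`; FILE A `finrank_fixedPoints_ofChar` and H2
«DET-LEVELS» `comp_detZ_eq_one_on_iff` at `K₀ ≥ I`, `K₁ ≥ I`, `I ∋ d(1,b,1)` (FILE C)). [cite: Rogawski1990, §12.6 Prop. 12.6.1 (b) p. 188; §12.2 (1) p. 173] [cite: Kottwitz1988, §2 Theorem 2] -/
theorem smoothTrace_detG_ep (hns : ∀ w' : PlacesOver L v, IsCMField.complexConj L • w'.1 = w'.1) {ϖ : w.1.adicCompletion L}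
    (hd : HermitianLattice.UnramifiedLocalConjDatum (galAdicCompletionMap (L := L) (IsCMField.complexConj L) hw) ϖ)
    (g₁ : GL (Fin 3) (w.1.adicCompletion L)) (hg₁ : (g₁ : Matrix (Fin 3) (Fin 3) (w.1.adicCompletion L)) = Matrix.diagonal ![(1 : w.1.adicCompletion L), 1, ϖ])
    (K0 K1 I : Subgroup (Gqs L v))
    (hK0 : K0 = ((glInt 3 (w.1.adicCompletion L)).subgroupOf
      (unitaryGroupOfForm (galAdicCompletionMap (L := L) (IsCMField.complexConj L) hw) ((StdForm.antidiagonal 3).over (w.1.adicCompletion L)))).comap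
        eA.toMulEquiv.toMonoidHom)
    (hK1 : K1 = (((glInt 3 (w.1.adicCompletion L)).map (MulAut.conj g₁).toMonoidHom).subgroupOf
      (unitaryGroupOfForm (galAdicCompletionMap (L := L) (IsCMField.complexConj L) hw) ((StdForm.antidiagonal 3).over (w.1.adicCompletion L)))).comap
        eA.toMulEquiv.toMonoidHom)
    (hI : I = K0 ⊓ K1)
    [MeasurableSpace (Gqs L v)] [BorelSpace (Gqs L v)] (νQv : Measure (Gqs L v)) [νQv.IsHaarMeasure]
    (fG : Gqs L v → ℂ)
    (hfG : fG = fun g => (((νQv K0).toReal : ℂ))⁻¹ * (K0 : Set (Gqs L v)).indicator (fun _ => (1 : ℂ)) g +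
      (((νQv K1).toReal : ℂ))⁻¹ * (K1 : Set (Gqs L v)).indicator (fun _ => (1 : ℂ)) g -
      (((νQv I).toReal : ℂ))⁻¹ * (I : Set (Gqs L v)).indicator (fun _ => (1 : ℂ)) g)
    (ι : ↥(normOneUnits (conjLocal L (IsCMField.complexConj L) v)) →* ↥(Subgroup.center (Gqs L v)))
    (hι : ∀ z : ↥(normOneUnits (conjLocal L (IsCMField.complexConj L) v)),
      ((ι z).val.val.val : Matrix (Fin 3) (Fin 3) (LocalRing L v)) = (((z : (LocalRing L v)ˣ) : LocalRing L v)) • (1 : Matrix (Fin 3) (Fin 3) (LocalRing L v)))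
    (detZ : Gqs L v →* ↥(Subgroup.center (Gqs L v)))
    (hdetZ : ∀ g : Gqs L v, ((detZ g).val.val.val : Matrix (Fin 3) (Fin 3) (LocalRing L v)) =
        (g.val.val : Matrix (Fin 3) (Fin 3) (LocalRing L v)).det • (1 : Matrix (Fin 3) (Fin 3) (LocalRing L v)))
    (detG : (↥(Subgroup.center (Gqs L v)) →* ℂˣ) → IrrClass (Gqs L v))
    (ψ : ↥(Subgroup.center (Gqs L v)) →* ℂˣ)
    (hopen : IsOpen (((ψ.comp detZ).ker : Subgroup (Gqs L v)) : Set (Gqs L v)))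
    (hdet : detG ψ = IrrClass.mk (SmoothIrrep.ofChar (ψ.comp detZ) hopen)) :
    (detG ψ).smoothTrace νQv fG = if ψ = 1 then 1 else 0 := by
  haveI : NonarchimedeanGroup (Gqs L v) := nonarchimedeanGroup_cmLocal L 3 v
  haveI : LocallyCompactSpace (Gqs L v) := locallyCompactSpace_cmDatum_local (L := L) (N := 3) (H := qsForm L) (v := v)
  obtain ⟨hK0o, hK0c, hK1o, hK1c, hIo, hIc⟩ := isOpen_isCompact_epLevels L v w hw g₁ eA K0 K1 I hK0 hK1 hI
  obtain ⟨hμ0, hμ1, hμI⟩ := measureReal_epLevels_ne_zero L v w hw g₁ eA K0 K1 I hK0 hK1 hI νQv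
  have hshape := IrrClass.smoothTrace_mk_epShape νQv (SmoothIrrep.ofChar (ψ.comp detZ) hopen)
    (isAdmissible_smoothIrrep L v hns _) hK0o hK0c hK1o hK1c hIo hIc hμ0 hμ1 hμI
  rw [hfG, epShape_eq, hdet, hshape, finrank_fixedPoints_ofChar (ψ.comp detZ) hopen K0, finrank_fixedPoints_ofChar (ψ.comp detZ) hopen K1,
    finrank_fixedPoints_ofChar (ψ.comp detZ) hopen I]
  -- H2 «DET-LEVELS» at the three levels (each contains the `d(1,b,1)`, `b ∈ E¹_v`: FILE C `mem_I_of_coe_eq_diagonal`, `I ≤ K₀`, `I ≤ K₁`)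
  have hdI : ∀ b : ↥(normOneUnits (conjLocal L (IsCMField.complexConj L) v)), ∀ g : Gqs L v,
      (g.val.val : Matrix (Fin 3) (Fin 3) (LocalRing L v)) = Matrix.diagonal ![(1 : LocalRing L v), ((b : (LocalRing L v)ˣ) : LocalRing L v), 1] → g ∈ I :=
    fun b g hg => mem_I_of_coe_eq_diagonal L v w hw eA heA hns hd g₁ hg₁ K0 K1 I hK0 hK1 hI b g hg
  have e0 : (∀ k ∈ K0, (ψ.comp detZ) k = 1) ↔ ψ = 1 := by
    simp only [MonoidHom.comp_apply]
    exact comp_detZ_eq_one_on_iff L v hns ι hι detZ hdetZ K0 (fun b g hg => I_le_K0 L v K0 K1 I hI (hdI b g hg)) ψ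
  have e1 : (∀ k ∈ K1, (ψ.comp detZ) k = 1) ↔ ψ = 1 := by
    simp only [MonoidHom.comp_apply]
    exact comp_detZ_eq_one_on_iff L v hns ι hι detZ hdetZ K1 (fun b g hg => I_le_K1 L v K0 K1 I hI (hdI b g hg)) ψ
  have eI : (∀ k ∈ I, (ψ.comp detZ) k = 1) ↔ ψ = 1 := by
    simp only [MonoidHom.comp_apply]
    exact comp_detZ_eq_one_on_iff L v hns ι hι detZ hdetZ I hdI ψ
  by_cases hψ1 : ψ = 1
  · rw [if_pos (e0.2 hψ1), if_pos (e1.2 hψ1), if_pos (eI.2 hψ1), if_pos hψ1]; norm_num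
  · rw [if_neg (fun h => hψ1 (e0.1 h)), if_neg (fun h => hψ1 (e1.1 h)), if_neg (fun h => hψ1 (eI.1 h)), if_neg hψ1]; norm_num

/-! ## §3 The conjugate character of the compact centre: continuous, unitary, `ψ · conj ψ′ = 1 ↔ ψ = ψ′` -/

/-- `conj ∘ ψ` is continuous when `ψ` is. [cite: BushnellHenniart2006, §9.5 (9.5.1) p. 65] -/
theorem continuous_conjChar {Z : Type*} [TopologicalSpace Z] [Group Z] (ψ : Z →* ℂˣ) (hψ : Continuous ψ) :
    Continuous ⇑((Units.map ((starRingEnd ℂ : ℂ →+* ℂ) : ℂ →* ℂ)).comp ψ) :=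
  (Continuous.units_map ((starRingEnd ℂ : ℂ →+* ℂ) : ℂ →* ℂ) (by exact Complex.continuous_conj)).comp hψ

/-- A continuous character `ψ′` of the COMPACT centre `Z(G_v)` (non-split `v`, ★ `isCompact_center_Gqs`) is unitary, so its conjugate character is unitary too:
`‖conj ψ′(z)‖ = 1`. [cite: Rogawski1990, §12.2 (1) p. 173] -/
theorem norm_conjChar_eq_one (hns : ∀ w' : PlacesOver L v, IsCMField.complexConj L • w'.1 = w'.1)
    (ψ' : ↥(Subgroup.center (Gqs L v)) →* ℂˣ) (hψ' : Continuous ψ') (z : ↥(Subgroup.center (Gqs L v))) :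
    ‖((((Units.map ((starRingEnd ℂ : ℂ →+* ℂ) : ℂ →* ℂ)).comp ψ') z : ℂˣ) : ℂ)‖ = 1 := by
  haveI : CompactSpace ↥(Subgroup.center (Gqs L v)) := isCompact_iff_compactSpace.1 (F0P3cStCharTSParField.isCompact_center_Gqs L v hns)
  rw [IrrClass.coe_unitsMap_starRingEnd_comp_apply, Complex.norm_conj]
  exact norm_centerChar_eq_one ψ' (Units.continuous_val.comp hψ') z

/-- **`conj ψ′ = ψ′⁻¹`** for a continuous character of the compact centre (`z⁻¹ = conj z` on the unit circle). [cite: Rogawski1990, §12.2 (1) p. 173] -/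
theorem conjChar_eq_inv (hns : ∀ w' : PlacesOver L v, IsCMField.complexConj L • w'.1 = w'.1)
    (ψ' : ↥(Subgroup.center (Gqs L v)) →* ℂˣ) (hψ' : Continuous ψ') :
    (Units.map ((starRingEnd ℂ : ℂ →+* ℂ) : ℂ →* ℂ)).comp ψ' = ψ'⁻¹ := by
  haveI : CompactSpace ↥(Subgroup.center (Gqs L v)) := isCompact_iff_compactSpace.1 (F0P3cStCharTSParField.isCompact_center_Gqs L v hns)
  refine MonoidHom.ext fun z => Units.val_inj.1 ?_
  rw [IrrClass.coe_unitsMap_starRingEnd_comp_apply, MonoidHom.inv_apply, Units.val_inv_eq_inv_val]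
  exact (Complex.inv_eq_conj (norm_centerChar_eq_one ψ' (Units.continuous_val.comp hψ') z)).symm

/-- **`ψ · conj ψ′ = 1 ↔ ψ = ψ′`** for continuous characters of the compact centre. [cite: Rogawski1990, §12.2 (1) p. 173] -/
theorem mul_conjChar_eq_one_iff (hns : ∀ w' : PlacesOver L v, IsCMField.complexConj L • w'.1 = w'.1)
    (ψ ψ' : ↥(Subgroup.center (Gqs L v)) →* ℂˣ) (hψ' : Continuous ψ') :
    ψ * (Units.map ((starRingEnd ℂ : ℂ →+* ℂ) : ℂ →* ℂ)).comp ψ' = 1 ↔ ψ = ψ' := by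
  rw [conjChar_eq_inv L v hns ψ' hψ']
  constructor
  · intro h
    refine MonoidHom.ext fun z => ?_
    have hz := DFunLike.congr_fun h z
    rw [MonoidHom.mul_apply, MonoidHom.inv_apply, MonoidHom.one_apply, mul_inv_eq_one] at hz
    exact hz
  · rintro rfl
    refine MonoidHom.ext fun z => ?_
    rw [MonoidHom.mul_apply, MonoidHom.inv_apply, MonoidHom.one_apply, mul_inv_cancel]

/-- `((conj ψ′) ∘ detZ)` has the kernel of `ψ′ ∘ detZ`, hence an open one. [cite: BushnellHenniart2006, §9.5 (9.5.1) p. 65] -/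
theorem isOpen_ker_conjChar_comp (detZ : Gqs L v →* ↥(Subgroup.center (Gqs L v))) (ψ' : ↥(Subgroup.center (Gqs L v)) →* ℂˣ)
    (hopen' : IsOpen (((ψ'.comp detZ).ker : Subgroup (Gqs L v)) : Set (Gqs L v))) :
    IsOpen ((((((Units.map ((starRingEnd ℂ : ℂ →+* ℂ) : ℂ →* ℂ)).comp ψ').comp detZ).ker : Subgroup (Gqs L v))) : Set (Gqs L v)) := by
  rw [MonoidHom.comp_assoc, IrrClass.ker_unitsMap_starRingEnd_comp]
  exact hopen'

end Summit.HodgeConjecture.HodgeConjecture.Cruxes.H413.F0P3cStCharTSEPTraces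

end
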